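import Summits.QuantumFields.BalabanUV.T4Continuum.Spine.NE5.TwoRunTorusWalkOutputLetters
import Summits.QuantumFields.BalabanUV.T4Continuum.Spine.NE5.TwoRunTorusNE5Pencil

/-!
# Spine/NE5/TwoRunTorusNE5Late — the minimal END (T39) asking the two-run PENCIL record only at the WINDOW scales
# `θ^j < s`; at the early scales `θ^j ≥ s` it takes the two members' ONE-RUN bounds instead (cell `pub-balaban-gaps`, seat
# `ne5` gen 14; located point (x17′) repaired)

WHY.  T39 `TwoRunTorusNE5Records.ne5_of_records_symm_all_scales` (and every END above it: T41, T43, T45, T47) asks, at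
EVERY creation scale `j`, for a walk record of the two-run pencil kernels admissible at size `α j > 1`, i.e. analytic on a
configuration ball of radius `R_j ≥ α j·C_R ≥ 2C_R` (T46: `R_j = max 2 (s∕θ^j)·C_R`, `C_R > 2` large when NODE A's
smallness `ϑ` is small).  By T42 `TwoRunPencilDiagonal.termWalkData_pencil_diag` a producer's pencil record reaches radius
`min(R, s₀∕r_j)` only, `r_j` the two runs' closeness in walk-weighted currency: so the END demands `r_j ≤ s₀∕(2C_R)` even at
`j = 0` — an ABSOLUTE closeness of run A's step-0 and run B's step-1 data, whereas the printed mechanism gives a RATE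
(C. King, CMP 102 p. 665: «the desired factor L^{−γk}», which is O(1) at k = 0) — located point (x17′) of `HOME/ne/NE5.md`
§20.  But the END USES the record at the early scales `θ^j ≥ s` only to bound the two members `E j 0`, `E j 1` (T30
`TwoRunTorusNE5Pencil.ne5_of_output_pencils`' early-scale clause: there `C₅θ^j = 2Aθ^j∕s ≥ 2A`, so the one-run bounds
suffice), and each member's bound is exactly what Bałaban's printed Lemma 3 ∕ (2.41) gives for ONE run ([II] p. 21).
THIS FILE, `ne5_of_records_symm_late`: T39 VERBATIM except that (i) every hypothesis that reads the records (`h𝒦`,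
`hlin`, `hAhol`, `hGhol`, `hVholb`, `hVm`, `hAs`, `h220U`, `hm`, `hfibN`, `hθR1le`, `hvol`, `hH`, `h213`) is asked only
for `θ^j < s`, and (ii) two new hypotheses `hE0`, `hE1` give the members' one-run bounds
`‖E j b X φ‖ ≤ A₂C₃ε₁·e^{−(1−10δ)½Lκ·d_j(X)}` (`b = 0, 1`) at every scale.  Proof = T39's (T29 per window scale, T30).  So a
producer with the two-run RATE `r_j ≤ C₂θ^j` meets the END by choosing the margin `s` small (`2C₂C_R s ≤ s₀`): at the
window scales `r_j·R_j ≤ C₂θ^j·(s∕θ^j)·C_R·… ≤ s₀`, and at the early scales nothing two-run is asked.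

HONEST FRAMING.  Hypothesis bookkeeping over landed shapes (T39's signature with guards; proof by T29 + T30 by name);
nothing of Bałaban's is constructed or asserted beyond print.  NE5 NOT PRINTED ∕ NOT PROVED; leaves 0∕12; (D4) 0∕1; spine
0∕9.  Rung (B)+1 on a FIXED finite T⁴ — NOT continuum, NOT infinite volume, NOT mass gap, NOT Clay.  HONEST DEPENDENCY:
continuum YM on T⁴ ⇐ BetaPertH ∧ nine spine estimates; BetaPertH ⇐ (D1) ∧ (D4) ∧ CAP+tail.  0 sorry, 0 `def`.

Sources: [II] = T. Bałaban, CMP **116** (1988) [Balaban1988RG2Cluster] (1.11) p. 5, p. 13, p. 15, (2.13)–(2.26) pp. 14–17,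
(2.38) p. 20, (2.41) p. 21; [I] = CMP **109** (1987) [Balaban1987RG1] (0.24)–(0.25) p. 257, (1.18) p. 263; [B9] = CMP **99**
(1985) [Balaban1985BackgroundPropagators] Thm 3.10 p. 416; C. King, CMP **102** (1986) [King1986] Thm 3.4 p. 656, p. 665.
Nothing here is a claim about the Yang–Mills mass gap.
-/

noncomputable section

namespace Summit.QuantumFields.BalabanUV.T4Continuum.Spine.NE5.TwoRunTorusNE5Late

open Matrix Metric Set Finset
open Literature.MathematicalPhysics.QuantumFieldTheory.Balaban1983to89
open Literature.MathematicalPhysics.QuantumFieldTheory.Balaban1983to89.T4OutputRate (NE5)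
open Literature.MathematicalPhysics.QuantumFieldTheory.Balaban1983to89.TreeLengthTorus (TPt TDom tsys)
open Literature.MathematicalPhysics.QuantumFieldTheory.Balaban1983to89.TreeLengthTorusGeometry (TTouch)
open Literature.MathematicalPhysics.QuantumFieldTheory.Balaban1983to89.TreeLengthTorusTransfer (tclosure)
open Literature.MathematicalPhysics.QuantumFieldTheory.Balaban1983to89.B13Lemma3TorusData (TBond)
open Literature.MathematicalPhysics.QuantumFieldTheory.Balaban1983to89.B13Lemma3Torus (TwoTorusStep)
open Literature.MathematicalPhysics.QuantumFieldTheory.Balaban1983to89.B13Lemma3TorusTerms (terms weight Z0)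
open Literature.MathematicalPhysics.QuantumFieldTheory.Balaban1983to89.B13Term214 (core214 F214 term214)
open Literature.MathematicalPhysics.QuantumFieldTheory.Balaban1983to89.B13Bound143 (invTau)
open Literature.MathematicalPhysics.QuantumFieldTheory.Balaban1983to89.B5TorusCover (UT)
open Literature.MathematicalPhysics.QuantumFieldTheory.Balaban1983to89.B12TreeDecay (kappa₀ K₀)
open Literature.MathematicalPhysics.QuantumFieldTheory.Balaban1983to89.B13Resummation (locE)
open Literature.MathematicalPhysics.QuantumFieldTheory.Balaban1983to89.B13TermWalkData
  (WalkConsts TermKernels TermWalkData)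
open Literature.MathematicalPhysics.QuantumFieldTheory.Balaban1983to89.B13TermWalkDataOneTorus (SmallTheta)
open Summit.QuantumFields.BalabanUV.T4Continuum.Spine.NE5.TwoRunTorusWalkOutputLetters
  (differentiableOn_E_torus_of_records_symm)
open Summit.QuantumFields.BalabanUV.T4Continuum.Spine.NE5.TwoRunTorusNE5 (torusCarriers reFunctional)
open Summit.QuantumFields.BalabanUV.T4Continuum.Spine.NE5.TwoRunTorusNE5Pencil (ne5_of_output_pencils)

variable {L : ℕ} [NeZero L] {M : ℕ} [NeZero M]
variable {ν : ℕ} {Nf : ℕ → Fin ν → ℕ} [∀ j i, NeZero (Nf j i)]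

open Classical in
/-- **THE MINIMAL END WITH THE PENCIL RECORD ASKED AT THE WINDOW SCALES ONLY.**  T39 `ne5_of_records_symm_all_scales`
VERBATIM, except: the record-reading hypotheses (`h𝒦 hlin hAhol hGhol hVholb hVm hAs h220U hm hfibN hθR1le hvol hH h213`)
carry the guard `θ ^ j < s →`, and two hypotheses `hE0`, `hE1` give at EVERY scale the two members' one-run bounds
`‖E j 0 X φ‖, ‖E j 1 X φ‖ ≤ A₂C₃ε₁·exp(−(1−10δ)½Lκ·d_j X)` (each run's own Lemma 3 ∕ (2.41), [II] p. 21; [I] (0.24)–(0.25)).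
Conclusion unchanged: `NE5 (torus carriers) (E·0) (E·1) W′ ((1−10δ)½Lκ) θ (2A₂C₃ε₁∕s)` BY NAME.  Proof: T29
`differentiableOn_E_torus_of_records_symm` at the window scales, T30 `ne5_of_output_pencils` with the members' clause fed
by `hE0`∕`hE1`.  (Why: the early scales use the record only for the members' bounds; asking it there forces an absolute
two-run closeness at j = 0 — located point (x17′) — where print has a rate, King p. 665.)
[cite: Balaban1987RG1, (0.24)–(0.25) p.257, (1.18) p.263; Balaban1988RG2Cluster, (1.11) p.5, p.13, p.15, (2.13)–(2.26) pp.14–17, (2.38) p.20, (2.41) p.21; Balaban1985BackgroundPropagators, Thm 3.10 p.416; King1986, Thm 3.4 p.656, p.665] -/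
theorem ne5_of_records_symm_late (c : B13.Consts) (hL : 8 ≤ c.L) (hLc : c.L = L) (hκ₁ : 1 ≤ c.κ₁)
    (hα₆' : c.α₆ ≠ 0) (N : ℕ → ℕ) [∀ j, NeZero (N j)] (W : (j : ℕ) → TwoTorusStep 4 L (N j))
    {θ s : ℝ} (hθ : 0 < θ) (hs : 0 < s)
    -- regions, radii, contour radius, parameter lists, per scale
    (hpos : ∀ j, ∀ Y : TDom 4 (L * N j), 0 < invTau c ((tsys 4 (L * N j)).dj Y))
    (hhalf : ∀ j, ∀ Y : TDom 4 (L * N j), invTau c ((tsys 4 (L * N j)).dj Y) ≤ 1 / 2)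
    {Uτ : (j : ℕ) → TDom 4 (L * N j) → Set ℂ} (hUτ : ∀ j Y, IsOpen (Uτ j Y))
    (hUtau : ∀ j, ∀ Y : TDom 4 (L * N j), closedBall (0 : ℂ) ((invTau c ((tsys 4 (L * N j)).dj Y))⁻¹) ⊆ Uτ j Y)
    {r : ℝ} (hr : 0 < r) (hr' : r ≤ Real.exp c.κ₁ - 1)
    (hsubτ : ∀ j Y, ∀ ζ ∈ Set.uIcc (0 : ℝ) 1, closedBall (ζ : ℂ) r ⊆ Uτ j Y)
    (lZ : (j : ℕ) → TDom 4 (N j) → Finset (TDom 4 (L * N j)) × Finset (TBond 4 M (L * N j)) → List (TPt 4 (N j)))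
    (hlZ : ∀ j Z t, (lZ j Z t).Nodup ∧ (lZ j Z t).toFinset = Z.1 \ tclosure L (N j) (Z0 M t))
    (lD : (j : ℕ) → Finset (TDom 4 (L * N j)) × Finset (TBond 4 M (L * N j)) → List (TDom 4 (L * N j)))
    (hlD : ∀ j t, (lD j t).Nodup ∧ (lD j t).toFinset = t.1)
    -- PER-SCALE, PER-TERM WALK RECORDS AT `c⁺` OVER THE PENCIL, ONE ADMISSIBLE PACKAGE PER SCALE AT THE WINDOW SIZE
    (𝒦 : (j : ℕ) → (Z : TDom 4 (N j)) → Finset (TDom 4 (L * N j)) × Finset (TBond 4 M (L * N j)) → (W j).Φ →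
      TermKernels ({ c with κ₁ := c.κ₁ + 1 } : B13.Consts) 4 (N j) ν (Nf j) ℂ)
    [∀ j Z t φ, Fintype (𝒦 j Z t φ).C₀] [∀ j Z t φ, DecidableEq (𝒦 j Z t φ).C₀]
    {w : ℕ → WalkConsts} {α Rσ₀ : ℕ → ℝ} (hw : ∀ j, (w j).Admissible (α j) (Rσ₀ j))
    (hα1 : ∀ j, 1 < α j) (hαs : ∀ j, θ ^ j < s → s / θ ^ j ≤ α j)
    (h𝒦 : ∀ j, θ ^ j < s → ∀ Z, ∀ t ∈ terms L M Z, ∀ φ, φ ∈ (W j).sp2 Z → TermWalkData (𝒦 j Z t φ) (w j))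
    (Γ : (j : ℕ) → (Z : TDom 4 (N j)) → (t : Finset (TDom 4 (L * N j)) × Finset (TBond 4 M (L * N j))) →
      (φ : (W j).Φ) → ℂ → (TPt 4 (N j) → ℂ) → ((𝒦 j Z t φ).Λ ⊕ (𝒦 j Z t φ).C₀ → ℝ) → ((𝒦 j Z t φ).Λ → ℂ))
    (hlin : ∀ j, θ ^ j < s → ∀ Z, ∀ t ∈ terms L M Z, ∀ φ, φ ∈ (W j).sp2 Z → ∀ b ∈ ball (0 : ℂ) (α j), ∀ σ : TPt 4 (N j) → ℂ,
      (∀ i, σ i ∈ ball (0 : ℂ) (Real.exp (c.κ₁ + 1))) →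
        ∀ X : (𝒦 j Z t φ).Λ ⊕ (𝒦 j Z t φ).C₀ → ℝ, Γ j Z t φ b σ X = (𝒦 j Z t φ).G2 σ b *ᵥ fun i => (X i : ℂ))
    (χY₀ χcP : (j : ℕ) → (Z : TDom 4 (N j)) → (t : Finset (TDom 4 (L * N j)) × Finset (TBond 4 M (L * N j))) →
      (φ : (W j).Φ) → ((𝒦 j Z t φ).Λ → ℝ) → ℝ)
    (hχ0 : ∀ j Z t φ Bf, 0 ≤ χY₀ j Z t φ Bf) (hχc0 : ∀ j Z t φ Bf, 0 ≤ χcP j Z t φ Bf)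
    (Dfam : (j : ℕ) → TDom 4 (N j) → Finset (TDom 4 (L * N j)) × Finset (TBond 4 M (L * N j)) →
      Finset (TDom 4 (L * N j)))
    (Vk : (j : ℕ) → (Z : TDom 4 (N j)) → (t : Finset (TDom 4 (L * N j)) × Finset (TBond 4 M (L * N j))) →
      (φ : (W j).Φ) → ℂ → TDom 4 (L * N j) → ((𝒦 j Z t φ).Λ → ℝ) → ℂ)
    -- non-walk data per scale: σ-holomorphy (NODE O), SYMMETRY (NODE A; `Re ≻ 0` is read from the record), potentials
    (hAhol : ∀ j, θ ^ j < s → ∀ Z, ∀ t ∈ terms L M Z, ∀ φ, φ ∈ (W j).sp2 Z → ∀ b ∈ ball (0 : ℂ) (α j), ∀ i i',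
      DifferentiableOn ℂ (fun σ => (𝒦 j Z t φ).A2 σ b i i')
        {σ | ∀ i, σ i ∈ ball (0 : ℂ) (Real.exp (c.κ₁ + 1))})
    (hGhol : ∀ j, θ ^ j < s → ∀ Z, ∀ t ∈ terms L M Z, ∀ φ, φ ∈ (W j).sp2 Z → ∀ b ∈ ball (0 : ℂ) (α j), ∀ i i',
      DifferentiableOn ℂ (fun σ => (𝒦 j Z t φ).G2 σ b i i')
        {σ | ∀ i, σ i ∈ ball (0 : ℂ) (Real.exp (c.κ₁ + 1))})
    (hVholb : ∀ j, θ ^ j < s → ∀ Z, ∀ t ∈ terms L M Z, ∀ φ, φ ∈ (W j).sp2 Z → ∀ Y Bf,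
      DifferentiableOn ℂ (fun b => Vk j Z t φ b Y Bf) (ball (0 : ℂ) (α j)))
    (hχm : ∀ j Z t φ, Measurable (χY₀ j Z t φ)) (hχcm : ∀ j Z t φ, Measurable (χcP j Z t φ))
    (hVm : ∀ j, θ ^ j < s → ∀ Z, ∀ t ∈ terms L M Z, ∀ φ, φ ∈ (W j).sp2 Z → ∀ b ∈ ball (0 : ℂ) (α j), ∀ Y,
      Measurable (Vk j Z t φ b Y))
    (hAs : ∀ j, θ ^ j < s → ∀ Z, ∀ t ∈ terms L M Z, ∀ φ, φ ∈ (W j).sp2 Z → ∀ b : ℂ, ‖b‖ ≤ α j → ∀ σ : TPt 4 (N j) → ℂ,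
      (∀ i, ‖σ i‖ ≤ Real.exp (c.κ₁ + 1)) → ((𝒦 j Z t φ).A2 σ b).IsSymm)
    -- (2.22) and (2.20), uniform along the pencil, per scale
    {γ₂ rP a₂₀ w₂₀ : ℝ}
    (qP : (j : ℕ) → (Z : TDom 4 (N j)) → (t : Finset (TDom 4 (L * N j)) × Finset (TBond 4 M (L * N j))) →
      (φ : (W j).Φ) → ((𝒦 j Z t φ).Λ → ℝ) → ℝ)
    (h222 : ∀ j Z t φ Bf, χY₀ j Z t φ Bf * χcP j Z t φ Bf ≤
      Real.exp (-(γ₂ / 2 * rP ^ 2 * (t.2.card : ℕ)) + γ₂ / 2 * qP j Z t φ Bf))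
    (hγ₂ : 0 ≤ γ₂) (hqP : ∀ j Z t φ Bf, qP j Z t φ Bf ≤ Bf ⬝ᵥ Bf) (ha0 : 0 ≤ a₂₀)
    (h220U : ∀ j, θ ^ j < s → ∀ Z, ∀ t ∈ terms L M Z, ∀ φ, φ ∈ (W j).sp2 Z → ∀ b ∈ ball (0 : ℂ) (α j),
      ∀ τ : TDom 4 (L * N j) → ℂ, (∀ Y, τ Y ∈ Uτ j Y) →
        ∀ Bf, ∑ Y ∈ Dfam j Z t, ‖τ Y‖ * ‖Vk j Z t φ b Y Bf‖ ≤ a₂₀ / 2 * (Bf ⬝ᵥ Bf) + w₂₀)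
    -- a common fibre bound
    {m : ℕ} (hm : ∀ j, θ ^ j < s → ∀ Z t φ, (𝒦 j Z t φ).m ≤ m)
    (hfibN : ∀ j, θ ^ j < s → ∀ Z t φ, ∀ x : UT (Nf j), (Finset.univ.filter fun i => (𝒦 j Z t φ).locN i = x).card ≤ m)
    -- one package of rates, NODE A's smallness `ϑ` BY NAME per scale, the p. 17 numerics in the records' letters
    {κa κb kap' kap'' ϑ : ℝ} (hκa : ∀ j, κa < (w j).kap) (hκb : κb < κa) (h2 : kap' < κb) (h1 : kap'' < kap')
    (hkap'' : 0 < kap'')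
    (hsm : ∀ j, SmallTheta (w j) (α j) ϑ)
    (hθR1le : ∀ j, θ ^ j < s → ∀ Z t φ, ((m : ℝ) * (1 + 2 / (κb - kap')) ^ ν) * (m * (1 + 2 / (kap' - kap'')) ^ ν)
      * ((2 * (w j).KbarΓ * Real.exp (-((w j).ε * (w j).Rσ)) + 2 * (w j).KbarΓ * α j / (w j).R) * (w j).KbarC
          * (w j).KbarΓ
        + (w j).KbarΓ * ((w j).KbarC * (2 * (w j).KbarE * Real.exp (-((w j).ε * (w j).Rσ))
            + 2 * (w j).KbarE * α j / (w j).R)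
            * ((𝒦 j Z t φ).m * (1 + 2 / ((w j).kap - κa)) ^ ν) * (w j).KbarC
            * ((𝒦 j Z t φ).m * (1 + 2 / (κa - κb)) ^ ν)) * (w j).KbarΓ
        + (w j).KbarΓ * (w j).KbarC * (2 * (w j).KbarΓ * Real.exp (-((w j).ε * (w j).Rσ))
            + 2 * (w j).KbarΓ * α j / (w j).R)) ≤ ϑ)
    (hsmallKθ : ∀ j, (w j).KbarC * (m * (1 + 2 / κb) ^ ν) * (ϑ * (m * (1 + 2 / kap'') ^ ν)) < 1)
    -- the operator letters `c_E`, `g` constrained FROM BELOW by the records' letters (T28), NODE A's positivity smallness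
    {cE g : ℝ} (hcE : ∀ j, (w j).KbarC * (m * (1 + 2 / (w j).kap) ^ ν) ≤ cE)
    (hgE : ∀ j, cE * ((w j).KbarΓ * (m * (1 + 2 / (w j).kap) ^ ν)) ^ 2 ≤ g)
    (hsmallRe : ∀ j, (2 * (w j).KbarE * Real.exp (-((w j).ε * (w j).Rσ)) + 2 * (w j).KbarE * α j / (w j).R)
      * (m * (1 + 2 / (w j).kap) ^ ν) * cE < 1)
    (hαc : (2 * (ϑ * (m * (1 + 2 / kap'') ^ ν)) + (γ₂ + a₂₀)) * cE ≤ 1 / 2)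
    (hsmall : (2 * (ϑ * (m * (1 + 2 / kap'') ^ ν)) + (γ₂ + a₂₀)) * (1 + 2 * cE * g) ≤ 1 / 2)
    {a a₅ : ℝ} (hPa : a ≤ γ₂ * rP ^ 2)
    (hvol : ∀ j, θ ^ j < s → ∀ Z, ∀ t ∈ terms L M Z, ∀ φ, φ ∈ (W j).sp2 Z →
      2 * ((w j).KbarC * (m * (1 + 2 / κb) ^ ν) * (ϑ * (m * (1 + 2 / kap'') ^ ν))
              * (1 + (1 - (w j).KbarC * (m * (1 + 2 / κb) ^ ν) * (ϑ * (m * (1 + 2 / kap'') ^ ν)))⁻¹) / 2)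
          * (Fintype.card (𝒦 j Z t φ).Λ : ℝ)
        + w₂₀ + (2 * (ϑ * (m * (1 + 2 / kap'') ^ ν)) + (γ₂ + a₂₀)) * cE * (Fintype.card (𝒦 j Z t φ).Λ : ℝ)
        + (2 * (ϑ * (m * (1 + 2 / kap'') ^ ν)) + (γ₂ + a₂₀)) * (1 + 2 * cE * g)
          * (Fintype.card ((𝒦 j Z t φ).Λ ⊕ (𝒦 j Z t φ).C₀) : ℝ)
        ≤ a₅ * ((Z.1).card : ℝ))
    -- Lemma 3's and (2.39)–(2.41)'s numbers, once (verbatim T17)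
    {a₂ a₂' Aabs : ℝ}
    (hα₆ : 0 < c.α₆) (hε₀ : 0 ≤ c.eps2) (hδ : 0 ≤ c.δ) (hδ7 : 0 ≤ 1 - 7 * c.δ) (hκ : 0 ≤ c.κ) (ha : 0 ≤ a)
    (hR15 : c.R15) (hR16 : 18 * ((1 - 4 * c.δ) * c.κ) ≤ a / 20) (hR16' : 4 * c.κ ≤ a / 20)
    (hR17 : Real.exp (-(a / 20)) ≤ c.eps2) (h231 : 2 * (4 : ℝ) * (M : ℝ) ^ 4 * Real.exp (-(a / 10)) ≤ a / 20)
    (ha₂ : 0 ≤ a₂) (hκ229 : kappa₀ 64 8 + a₂ ≤ c.δ * c.κ)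
    (hsm229 : c.α₆ * Real.exp a₂ * K₀ 64 8 * 64 ≤ a₂)
    (habsk : Real.exp (-(a / 20)) * 64 ≤ c.δ * c.κ)
    (h18half : B13Step237.R18half c (K₀ 64 8 * Real.exp (Real.exp (-(a / 20)) * 64)))
    (h18 : B13Step237.R18sharp c (K₀ 64 8 * Real.exp (Real.exp (-(a / 20)) * 64)) ((c.L : ℝ) / 2))
    (ha₂' : 0 ≤ a₂') (hκ229' : kappa₀ 64 8 + a₂' ≤ c.δ * ((c.L : ℝ) / 2) * c.κ)
    (hsm229' : c.α₆ * Real.exp a₂' * K₀ 64 8 * 64 ≤ a₂')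
    (hR20 : 18 * ((1 - 7 * c.δ) * ((c.L : ℝ) / 2) * c.κ) ≤ (c.κ₁ - 1) / 2)
    (ha₅ : 0 ≤ a₅) (habs : a₅ + Real.exp (-((c.κ₁ - 1) / 2)) ≤ Aabs)
    (hAc : Aabs * 64 ≤ c.δ * ((c.L : ℝ) / 2) * c.κ)
    (hC3 : B13Step237.bracketF c (K₀ 64 8 * Real.exp (Real.exp (-(a / 20)) * 64)) / c.α₆ *
      Real.exp (Aabs * 64) ≤ c.C3act * c.ε₁)
    -- the members' activities are the sums of the (2.14)-terms read from the records; (2.13); space restriction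
    {H : (j : ℕ) → ℂ → TDom 4 (N j) → (W j).Φ → ℂ}
    (hH : ∀ j, θ ^ j < s → ∀ b ∈ ball (0 : ℂ) (α j), ∀ (Z : TDom 4 (N j)) (φ : (W j).Φ), φ ∈ (W j).sp2 Z →
      H j b Z φ = ∑ t ∈ terms L M Z,
        term214 r (lZ j Z t) (lD j t) (core214 (fun σ => (𝒦 j Z t φ).A2 σ b) (Γ j Z t φ b)
          (F214 t.2.card (χY₀ j Z t φ) (χcP j Z t φ) (Dfam j Z t) (Vk j Z t φ b))) 0 0)
    (hsp : ∀ j, ∀ X Z : TDom 4 (N j), ∀ φ, Z.1 ⊆ X.1 → φ ∈ (W j).sp2 X → φ ∈ (W j).sp2 Z)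
    {E : (j : ℕ) → ℂ → TDom 4 (N j) → (W j).Φ → ℂ}
    (h213 : ∀ j, θ ^ j < s → ∀ b ∈ ball (0 : ℂ) (α j), ∀ (X : TDom 4 (N j)) (φ : (W j).Φ), φ ∈ (W j).sp2 X →
      E j b X φ = locE (TTouch (d := 4) (N := N j)) (fun Z : TDom 4 (N j) => Z.1) (fun Z => H j b Z φ) X.1)
    -- AT EVERY SCALE: the two MEMBERS' one-run bounds (each run's own Lemma 3 ∕ (2.41) output — what print gives per run)
    (hE0 : ∀ j (X : TDom 4 (N j)) (φ : (W j).Φ), φ ∈ (W j).sp2 X →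
      ‖E j 0 X φ‖ ≤ c.A₂ * c.C3act * c.ε₁ * Real.exp (-((1 - 10 * c.δ) * ((c.L : ℝ) / 2) * c.κ * (tsys 4 (N j)).dj X)))
    (hE1 : ∀ j (X : TDom 4 (N j)) (φ : (W j).Φ), φ ∈ (W j).sp2 X →
      ‖E j 1 X φ‖ ≤ c.A₂ * c.C3act * c.ε₁ * Real.exp (-((1 - 10 * c.δ) * ((c.L : ℝ) / 2) * c.κ * (tsys 4 (N j)).dj X)))
    (hAct : 0 ≤ c.C3act * c.ε₁) (hr₁ : 0 ≤ (1 - 10 * c.δ) * ((c.L : ℝ) / 2) * c.κ)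
    (hlarge : (1 - 10 * c.δ) * ((c.L : ℝ) / 2) * c.κ + 2 * (64 * Real.log 162) + 2 ≤
      (1 - 8 * c.δ) * ((c.L : ℝ) / 2) * c.κ)
    (hsmall41 : c.C3act * c.ε₁ * Real.exp (5 * ((1 - 10 * c.δ) * ((c.L : ℝ) / 2) * c.κ) + 1) * K₀ 64 8 * 9 * 64 ≤ 1)
    (hA₂ : Real.exp 1 * 9 * 64 * K₀ 64 8 ^ 2 ≤ c.A₂) (W' : Set (ℕ → ℝ)) :
    NE5 (C := torusCarriers N W) (reFunctional N W fun j => E j 0) (reFunctional N W fun j => E j 1) W'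
      ((1 - 10 * c.δ) * ((c.L : ℝ) / 2) * c.κ) θ (2 * (c.A₂ * c.C3act * c.ε₁) / s) := by
  -- the envelope constant is non-negative
  have hAp : 0 ≤ c.A₂ * c.C3act * c.ε₁ := by
    have hA₂0 : 0 ≤ c.A₂ := le_trans (by positivity) hA₂
    rw [mul_assoc]
    exact mul_nonneg hA₂0 hAct
  -- T29 at every scale: the output pencil on `ball 0 (α j)` from the records + symmetry, letters from the records
  have key : ∀ (j : ℕ), θ ^ j < s → ∀ (X : TDom 4 (N j)) (φ : (W j).Φ), φ ∈ (W j).sp2 X →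
      DifferentiableOn ℂ (fun b => E j b X φ) (ball (0 : ℂ) (α j)) ∧
        ∀ b ∈ ball (0 : ℂ) (α j), ‖E j b X φ‖ ≤ c.A₂ * c.C3act * c.ε₁ *
          Real.exp (-((1 - 10 * c.δ) * ((c.L : ℝ) / 2) * c.κ * (tsys 4 (N j)).dj X)) := fun j hj =>
    differentiableOn_E_torus_of_records_symm c hL hLc hκ₁ hα₆' (W j) (hpos j) (hhalf j) (hUτ j) (hUtau j) hr hr'
      (hsubτ j) (lZ j) (hlZ j) (lD j) (hlD j) (𝒦 j) (hw j) (one_pos.trans (hα1 j)) (h𝒦 j hj) (Γ j) (hlin j hj) (χY₀ j)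
      (χcP j) (hχ0 j) (hχc0 j) (Dfam j) (Vk j) (hAhol j hj) (hGhol j hj) (hVholb j hj) (hχm j) (hχcm j) (hVm j hj) (hAs j hj)
      (qP j) (h222 j) hγ₂ (hqP j) ha0 (h220U j hj) (hm j hj) (hfibN j hj) (hκa j) hκb h2 h1 hkap'' (hsm j) (hθR1le j hj)
      (hsmallKθ j) (hcE j) (hgE j) (hsmallRe j) hαc hsmall hPa (hvol j hj) hα₆ hε₀ hδ hδ7 hκ ha hR15 hR16 hR16' hR17
      h231 ha₂ hκ229 hsm229 habsk h18half h18 ha₂' hκ229' hsm229' hR20 ha₅ habs hAc hC3 (hH j hj) (hsp j) (h213 j hj) hAct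
      hr₁ hlarge hsmall41 hA₂
  -- T30: the members at every scale, the window where `θ^j < s`
  refine ne5_of_output_pencils N W E hAp hθ hs (fun j X φ hφ => ?_) (fun j hj X φ hφ => ?_) W'
  · exact ⟨hE0 j X φ hφ, hE1 j X φ hφ⟩
  · exact ⟨(key j hj X φ hφ).1.mono (ball_subset_ball (hαs j hj)),
      fun b hb => (key j hj X φ hφ).2 b (ball_subset_ball (hαs j hj) hb)⟩

end Summit.QuantumFields.BalabanUV.T4Continuum.Spine.NE5.TwoRunTorusNE5Late

end
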